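import Literature.AlgebraicGeometry.Motives.GrassmannianChartAffine
import Mathlib.LinearAlgebra.Pi
import Mathlib.LinearAlgebra.StdBasis
import Mathlib.Data.Fintype.Card
import Mathlib.Data.Set.Finite.Basic
import HarnessLib

/-!
# Matrix coordinates on the standard chart: `{ψ : Rⁿ → Aᵏ // ψ(e_{I i}) = eᵢ} ≅ A^{k(n−k)}`

Topic `Literature/AlgebraicGeometry/Motives`; namespace `Literature.AlgebraicGeometry.Motives`, prefix `Grassmannian.`.  Companion to
`GrassmannianChartAffine` ((C4): `chart x A ≃ {ψ : M →ₗ[R] Aᵏ // ψ ∘ x = e}`); cell hodgecm-mathlib key (h4) (author B-p21 (g15),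
partner B-p18 (g17)), deliverable (C4)-matrix form.  THEOREMS ONLY (no definition, instance, notation, `sorry`); §1 is pure
linear algebra over Mathlib, §2 composes it with ★ `chartEquivCoordMaps`.

For `M = Rⁿ` and the sub-frame `x = e ∘ I` of the standard basis (`I : Fin k → Fin n` injective), an `R`-linear coordinate map
`ψ : Rⁿ → Aᵏ` with `ψ(e_{I i}) = eᵢ` is a `k × n` matrix over `A` whose `I`-columns are the identity; the remaining `n − k` columns
are free.  [EisenbudHarris2016, §3.2.2]: «row-reduce so that the `I`-columns are the identity; the other `k(n−k)` entries are free
coordinates, `U_I ≅ 𝔸^{k(n−k)}`»; [Stacks 089T].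

* `Grassmannian.coordMaps_ext` — such `ψ` are determined by their non-`I` columns;
* `Grassmannian.exists_coordMap_of_matrix` — every choice of non-`I` columns occurs;
* **`Grassmannian.bijective_restrictMatrix`** — `ψ ↦ (j ↦ ψ(e_j))_{j ∉ I}` is a bijection
  `{ψ // ψ(e_{I i}) = eᵢ} ≃ ({j // j ∉ range I} → Aᵏ)`, natural in `A` (`restrictMatrix_compLeft`);
* `Grassmannian.card_compl_range` — there are `n − k` free columns (so the target is `A^{k(n−k)}`);
* **`Grassmannian.bijective_chart_matrixCoord`** — `U_I(A) = chart (e ∘ I) A → ({j // j ∉ range I} → Aᵏ)`,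
  `N ↦ (j ↦ coordMap N (e_j))`, is a bijection: the `A`-points of the standard chart ARE `A^{k(n−k)}`.

HC_CM is proved only modulo the 7 printed citations until rung 0 closes; nothing here is about HC.

## References
* [EisenbudHarris2016] D. Eisenbud, J. Harris, *3264 and All That* (2016), §3.2.2; [StacksProject, Tag 089T].
-/

set_option autoImplicit false

noncomputable section

universe u w

open TensorProduct

namespace Literature.AlgebraicGeometry.Motives

namespace Grassmannian

/-! ## §1 Matrices with prescribed identity columns -/

variable {R : Type u} [CommRing R] {k n : ℕ}
variable {A : Type w} [CommRing A] [Algebra R A] {B : Type w} [CommRing B] [Algebra R B]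

/-- Coordinate maps `Rⁿ → Aᵏ` normalised on the `I`-columns are determined by their non-`I` columns.
[cite: EisenbudHarris2016, §3.2.2] -/
theorem coordMaps_ext (I : Fin k → Fin n) {ψ ψ' : (Fin n → R) →ₗ[R] (Fin k → A)}
    (hψ : ∀ i, ψ (Pi.single (I i) 1) = Pi.single i 1) (hψ' : ∀ i, ψ' (Pi.single (I i) 1) = Pi.single i 1)
    (h : ∀ j, j ∉ Set.range I → ψ (Pi.single j 1) = ψ' (Pi.single j 1)) : ψ = ψ' := by
  refine (Pi.basisFun R (Fin n)).ext fun j => ?_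
  rw [Pi.basisFun_apply]
  by_cases hj : j ∈ Set.range I
  · obtain ⟨i, rfl⟩ := hj
    rw [hψ, hψ']
  · exact h j hj

/-- Every choice of the non-`I` columns is realised by a coordinate map normalised on the `I`-columns (`I` injective).
[cite: EisenbudHarris2016, §3.2.2] -/
theorem exists_coordMap_of_matrix (I : Fin k → Fin n) (hI : Function.Injective I)
    (v : {j : Fin n // j ∉ Set.range I} → (Fin k → A)) :
    ∃ ψ : (Fin n → R) →ₗ[R] (Fin k → A),
      (∀ i, ψ (Pi.single (I i) 1) = Pi.single i 1) ∧ ∀ (j) (hj : j ∉ Set.range I), ψ (Pi.single j 1) = v ⟨j, hj⟩ := by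
  classical
  -- all `n` columns: the identity on the `I`-columns, `v` elsewhere
  let w : Fin n → (Fin k → A) := fun j =>
    if h : ∃ i, I i = j then Pi.single h.choose 1 else v ⟨j, fun hj => h (Set.mem_range.1 hj)⟩
  refine ⟨(LinearEquiv.piRing R (Fin k → A) (Fin n) R).symm w, fun i => ?_, fun j hj => ?_⟩
  · rw [← LinearEquiv.piRing_apply (S := R), LinearEquiv.apply_symm_apply]
    have h : ∃ i', I i' = I i := ⟨i, rfl⟩
    change (if h : ∃ i', I i' = I i then Pi.single h.choose 1 else v ⟨I i, fun hj => h (Set.mem_range.1 hj)⟩) = _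
    rw [dif_pos h, hI h.choose_spec]
  · rw [← LinearEquiv.piRing_apply (S := R), LinearEquiv.apply_symm_apply]
    have h : ¬ ∃ i, I i = j := fun h => hj (Set.mem_range.2 h)
    change (if h : ∃ i, I i = j then Pi.single h.choose 1 else v ⟨j, fun hj => h (Set.mem_range.1 hj)⟩) = _
    rw [dif_neg h]

variable (A) in
/-- **`{ψ : Rⁿ → Aᵏ // ψ(e_{I i}) = eᵢ} ≅ ({j // j ∉ range I} → Aᵏ) = A^{k(n−k)}`**: restriction to the non-`I` columns is a
bijection (`I` injective).  Composed with ★ `chartEquivCoordMaps` this is the classical `U_I ≅ 𝔸^{k(n−k)}` on `A`-points.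
[cite: EisenbudHarris2016, §3.2.2] [cite: StacksProject, Tag 089T] -/
theorem bijective_restrictMatrix (I : Fin k → Fin n) (hI : Function.Injective I) :
    Function.Bijective
      (fun ψ : {ψ : (Fin n → R) →ₗ[R] (Fin k → A) // ∀ i, ψ (Pi.single (I i) 1) = Pi.single i 1} =>
        fun j : {j : Fin n // j ∉ Set.range I} => ψ.1 (Pi.single j.1 1)) := by
  refine ⟨fun ψ ψ' h => Subtype.ext (coordMaps_ext (R := R) (A := A) I ψ.2 ψ'.2 fun j hj => ?_), fun v => ?_⟩
  · have h' := congr_fun h ⟨j, hj⟩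
    exact h'
  obtain ⟨ψ, hψ, hv⟩ := exists_coordMap_of_matrix (R := R) (A := A) I hI v
  exact ⟨⟨ψ, hψ⟩, funext fun j => hv j.1 j.2⟩

/-- **Naturality in `A`** of the matrix coordinates: post-composition with an `R`-algebra map `f : A → B` on coordinate maps is
entrywise application of `f` on the columns. [cite: EisenbudHarris2016, §3.2.2] -/
theorem restrictMatrix_compLeft (f : A →ₐ[R] B) (ψ : (Fin n → R) →ₗ[R] (Fin k → A)) (j : Fin n) :
    (f.toLinearMap.compLeft (Fin k) ∘ₗ ψ) (Pi.single j 1) = f ∘ ψ (Pi.single j 1) :=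
  rfl

/-- Post-composition with `f` preserves the normalisation on the `I`-columns. [cite: EisenbudHarris2016, §3.2.2] -/
theorem compLeft_comp_single (f : A →ₐ[R] B) (I : Fin k → Fin n) (ψ : (Fin n → R) →ₗ[R] (Fin k → A))
    (hψ : ∀ i, ψ (Pi.single (I i) 1) = Pi.single i 1) (i : Fin k) :
    (f.toLinearMap.compLeft (Fin k) ∘ₗ ψ) (Pi.single (I i) 1) = Pi.single i 1 := by
  rw [restrictMatrix_compLeft, hψ]
  funext j
  rw [Function.comp_apply, Pi.single_apply, Pi.single_apply, apply_ite f, map_one, map_zero]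

/-- There are `n − k` free columns: `#{j // j ∉ range I} = n − k` for `I : Fin k → Fin n` injective (so the matrix coordinates
form `A^{k(n−k)}`). [cite: EisenbudHarris2016, §3.2.2] -/
theorem card_compl_range (I : Fin k → Fin n) (hI : Function.Injective I) :
    Fintype.card {j : Fin n // j ∉ Set.range I} = n - k := by
  classical
  have h1 : Fintype.card {j : Fin n // j ∈ Set.range I} = Fintype.card (Fin k) := by
    convert Set.card_range_of_injective hI
  rw [Fintype.card_fin] at h1
  rw [Fintype.card_subtype_compl, Fintype.card_fin, h1]

/-! ## §2 The `A`-points of the standard chart `U_I` of `G(k, Rⁿ)` are `A^{k(n−k)}` -/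

variable (A) in
/-- **`U_I(A) ≅ A^{k(n−k)}`**: for `I : Fin k → Fin n` injective, the map `N ↦ (j ↦ coordMap_{e∘I} N (e_j))_{j ∉ I}` from the
standard chart `chart (e ∘ I) A ⊆ G(k, A ⊗ Rⁿ; A)` to the `(n − k)`-tuples of columns in `Aᵏ` is a bijection — the composite of
★ `chartEquivCoordMaps` ((C4)) and `bijective_restrictMatrix`; natural in `A` by ★ `coordMap_map` and `restrictMatrix_compLeft`.
[cite: EisenbudHarris2016, §3.2.2] [cite: StacksProject, Tag 089T] -/
theorem bijective_chart_matrixCoord (I : Fin k → Fin n) (hI : Function.Injective I) :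
    Function.Bijective
      (fun N : chart R (Fin n → R) k (fun i => Pi.single (I i) (1 : R)) A =>
        fun j : {j : Fin n // j ∉ Set.range I} => coordMap _ N.1 N.2 (Pi.single j.1 1)) :=
  (bijective_restrictMatrix A I hI).comp
    (chartEquivCoordMaps R (Fin n → R) k (fun i => Pi.single (I i) (1 : R)) A).bijective

end Grassmannian

end Literature.AlgebraicGeometry.Motives

end
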